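import Summits.ValiantsHypothesis.ValiantsHypothesis.Theorems.KPlusLogSqLawTropicalBSeparatedThree

/-!
# Route «KPlusLogSqLaw», crux `TropicalB` (stmt-ValiantsHypothesis-19771) — SEPARATED SCALES KILL THE SECOND DIGIT, ALL SLOPES:
# saturation outside the lexicographic window and the bound `n ≤ 4m + 2` for every dominant chain of a pure lexicographic three-class design

HONEST FRAMING.  Helper toward the registered stubs `stub_tropThin` / `stub_tropFat` of `Cruxes/TropicalB/Lines/birth.lean`
(crux `Summit.ValiantsHypothesis.ValiantsHypothesis.Theses.KPlusLogSqLaw.TropicalB`, item stmt-ValiantsHypothesis-19771, route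
KPlusLogSqLaw; cell `pub-symmetroid`, seat val-sym-trop-p1 g8, 2026-08-27; `--supports … --as helper`).  A SECTOR theorem (three slope
classes, pure lexicographic valuations, dense top and bottom classes); nothing here bounds `TropicalB` for general designs or bears on
`WeakLifting`, DoorA26 / DoorA34, `MatrixDescartes` (stmt-ValiantsHypothesis-18050) or VP ≠ VNP.

CONTENT.  `chain_le_four_mul` (…TropicalBSeparatedThree) bounds chains inside the window `|θ| ≤ Θ = (2m+1)A + 1`.  Outside it the
design is frozen: at a slope `θ ≥ Θ` a dominant term puts EVERY column in the top class (`cls_eq_top_of_ge`, the top class being dense),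
at `θ ≤ −Θ` every column in the bottom class (`cls_eq_bot_of_le`); and two distinct terms with the same class map cannot both be
dominant (`not_dominant_of_cls_eq`: their weights differ by a slope-free constant).  Hence a dominant chain has at most one index beyond
each end of the window, and `chain_le_four_mul_add_two` gives **`n ≤ 4m + 2` for EVERY chain of terms dominant at strictly increasing
integer slopes** — a `TropRow`-shaped bound for the sector (linear in `m`; counting allows `(m+1)(m+2)/2 − 1`, SHIFT-THREE, which couples
the scales, realises `(m+1)(m+2)/2 − 2`).
-/

set_option linter.dupNamespace false
set_option autoImplicit false

namespace Summit.ValiantsHypothesis.ValiantsHypothesis.Theorems.KPlusLogSqLaw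

namespace SeparatedLex

open Summit.ValiantsHypothesis.ValiantsHypothesis.Theorems.MatrixDescartes.Negative
open Finset
open scoped BigOperators

variable {m K : ℕ}

/-- **Two distinct terms with the same class map are not both dominant** (at any two slopes): their weights differ by a constant. -/
theorem not_dominant_of_cls_eq (d : Fin K → ℕ) (v ε : Fin m → Fin m → Fin K → ℤ) {t t' : ℤ}
    {p p' : Equiv.Perm (Fin m) × (Fin m → Fin K)} (hp : IsDominant d v ε t p) (hp' : IsDominant d v ε t' p') (hne : p ≠ p')
    (hcls : p.2 = p'.2) : False := by
  have hW : ∀ s : ℤ, tropWeight d v s p - tropWeight d v s p' =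
      ∑ b, v (p'.1 b) b (p'.2 b) - ∑ b, v (p.1 b) b (p.2 b) := by
    intro s; unfold tropWeight; rw [hcls]; ring
  have h1 := hp.2 p' hne.symm hp'.1
  have h2 := hp'.2 p hne hp.1
  have e1 := hW t
  have e2 := hW t'
  linarith

/-- changing the class of one column changes the weight by that column's contribution only. [folklore] -/
theorem tropWeight_update (d : Fin K → ℕ) (v : Fin m → Fin m → Fin K → ℤ) (θ : ℤ)
    (p : Equiv.Perm (Fin m) × (Fin m → Fin K)) (b : Fin m) (j : Fin K) :
    tropWeight d v θ (p.1, Function.update p.2 b j) - tropWeight d v θ p =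
      (θ * (d j : ℤ) - v (p.1 b) b j) - (θ * (d (p.2 b) : ℤ) - v (p.1 b) b (p.2 b)) := by
  rw [RefreshExclusivity.tropWeight_eq_sum, RefreshExclusivity.tropWeight_eq_sum, ← Finset.sum_sub_distrib]
  rw [Finset.sum_eq_single b]
  · simp only [Function.update_self]
  · intro b' _ hb'
    simp only [Function.update_of_ne hb']; ring
  · intro h; exact absurd (Finset.mem_univ b) h

/-- **SATURATION ABOVE THE WINDOW.**  In a three-class pure lexicographic design whose TOP class is dense, a term dominant at a slope
`θ ≥ (2m+1)A + 1` has every column in the top class. -/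
theorem cls_eq_top_of_ge (d : Fin K → ℕ) (v ε : Fin m → Fin m → Fin K → ℤ) (u : Fin m → Fin m → Fin K → ℤ)
    (A : ℕ) (z w h : Fin K) (hwz : w ≠ z) (hhz : h ≠ z) (hdz : d z = 0) (hwh : d w < d h)
    (hcls : ∀ a b j, ε a b j ≠ 0 → j = z ∨ j = w ∨ j = h)
    (hu : ∀ a b j, j ≠ z → v a b j = (d j : ℤ) * u a b j) (huA : ∀ a b j, |u a b j| ≤ A) (hvz : ∀ a b, |v a b z| ≤ A)
    (hdenseh : ∀ a b, ε a b h ≠ 0)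
    (hsep : ∀ j j', d j < d j' → 8 * m ^ 2 * (A + 1) * d j ≤ d j') (hsep0 : ∀ j, j ≠ z → 8 * m ^ 2 * (A + 1) ≤ d j)
    {θ : ℤ} (hθ : (2 * m + 1) * A + 1 ≤ θ) {p : Equiv.Perm (Fin m) × (Fin m → Fin K)} (hp : IsDominant d v ε θ p) :
    ∀ b, p.2 b = h := by
  intro b
  by_contra hb
  have hm1 : (1 : ℤ) ≤ m := by
    have : 0 < m := Fin.pos b
    exact_mod_cast this
  have hA : (0 : ℤ) ≤ A := by positivity
  have hdh : (8 * (m : ℤ) ^ 2 * (A + 1)) ≤ d h := by exact_mod_cast hsep0 h hhz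
  -- the competitor: column `b` switched to the top class
  set q : Equiv.Perm (Fin m) × (Fin m → Fin K) := (p.1, Function.update p.2 b h) with hq
  have hpres := (termSign_ne_zero_iff ε p).1 hp.1
  have hq_pres : termSign ε q ≠ 0 := by
    rw [termSign_ne_zero_iff]; intro b'
    by_cases hb' : b' = b
    · subst hb'; simp only [q, Function.update_self]; exact hdenseh _ _
    · simp only [q, Function.update_of_ne hb']; exact hpres b'
  have hq_ne : q ≠ p := by
    intro hqp
    have : q.2 b = p.2 b := by rw [hqp]
    simp only [q, Function.update_self] at this
    exact hb this.symm
  have hdom := hp.2 q hq_ne hq_pres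
  have hdiff := tropWeight_update d v θ p b h
  have huh := huA (p.1 b) b h; rw [abs_le] at huh
  rw [hu _ _ h hhz] at hdiff
  -- the class of column `b` is `z` or `w`
  rcases hcls _ _ _ (hpres b) with e | e | e
  · rw [e, hdz] at hdiff; push_cast at hdiff
    have hv := hvz (p.1 b) b; rw [abs_le] at hv
    -- W q − W p = θ d_h − d_h u − (0 − v_z) ≥ Θ d_h − d_h A − A > 0
    have h1 : ((2 * m + 1) * A + 1) * (d h : ℤ) ≤ θ * (d h : ℤ) := mul_le_mul_of_nonneg_right hθ (by positivity)
    have h2 : (d h : ℤ) * u (p.1 b) b h ≤ (d h : ℤ) * A := mul_le_mul_of_nonneg_left huh.2 (by positivity)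
    have h3 : (0 : ℤ) ≤ (m : ℤ) * A * (d h : ℤ) := by positivity
    have h4 : (1 : ℤ) ≤ (m : ℤ) ^ 2 := by nlinarith [hm1]
    have h5 : (A : ℤ) ≤ (m : ℤ) ^ 2 * A := le_mul_of_one_le_left hA h4
    have hq1 : tropWeight d v θ q = tropWeight d v θ (p.1, Function.update p.2 b h) := rfl
    rw [hq1] at hdom
    linarith [h1, h2, h3, h5, hv.1, hdom, hdiff, hdh, hm1, hA]
  · rw [e] at hdiff
    rw [hu _ _ w hwz] at hdiff
    have huw := huA (p.1 b) b w; rw [abs_le] at huw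
    have hsw : 8 * (m : ℤ) ^ 2 * (A + 1) * (d w : ℤ) ≤ d h := by exact_mod_cast hsep w h hwh
    have hdw : (0 : ℤ) ≤ d w := by positivity
    -- W q − W p = θ (d_h − d_w) − d_h u_h + d_w u_w ≥ Θ (d_h − d_w) − d_h A − d_w A > 0
    have h0 : (d w : ℤ) < d h := by exact_mod_cast hwh
    have h1 : ((2 * m + 1) * A + 1) * ((d h : ℤ) - d w) ≤ θ * ((d h : ℤ) - d w) :=
      mul_le_mul_of_nonneg_right hθ (by linarith)
    have h2 : (d h : ℤ) * u (p.1 b) b h ≤ (d h : ℤ) * A := mul_le_mul_of_nonneg_left huh.2 (by positivity)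
    have h3 : (d w : ℤ) * (-(A : ℤ)) ≤ (d w : ℤ) * u (p.1 b) b w := mul_le_mul_of_nonneg_left huw.1 hdw
    have hone : (1 : ℤ) ≤ (m : ℤ) ^ 2 * (A + 1) := by nlinarith [hm1, hA]
    have h5 : 8 * (d w : ℤ) ≤ d h := by
      have := mul_le_mul_of_nonneg_right hone hdw
      linarith
    have hmA : (0 : ℤ) ≤ (m : ℤ) * A := by positivity
    have h7 : (m : ℤ) * A * (8 * (d w : ℤ)) ≤ (m : ℤ) * A * (d h : ℤ) := mul_le_mul_of_nonneg_left h5 hmA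
    have h8 : 1 * ((A : ℤ) * (d w : ℤ)) ≤ (m : ℤ) * ((A : ℤ) * (d w : ℤ)) := mul_le_mul_of_nonneg_right hm1 (by positivity)
    have h6 : (0 : ℤ) ≤ (m : ℤ) * A * (d w : ℤ) := by positivity
    have hq1 : tropWeight d v θ q = tropWeight d v θ (p.1, Function.update p.2 b h) := rfl
    rw [hq1] at hdom
    linarith [h0, h1, h2, h3, h7, h8, h6, hdom, hdiff]
  · exact hb e

/-- **SATURATION BELOW THE WINDOW.**  In a three-class pure lexicographic design whose BOTTOM class is dense, a term dominant at a slope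
`θ ≤ −((2m+1)A + 1)` has every column in the bottom class. -/
theorem cls_eq_bot_of_le (d : Fin K → ℕ) (v ε : Fin m → Fin m → Fin K → ℤ) (u : Fin m → Fin m → Fin K → ℤ)
    (A : ℕ) (z : Fin K) (hdz : d z = 0)
    (hu : ∀ a b j, j ≠ z → v a b j = (d j : ℤ) * u a b j) (huA : ∀ a b j, |u a b j| ≤ A) (hvz : ∀ a b, |v a b z| ≤ A)
    (hdense : ∀ a b, ε a b z ≠ 0) (hsep0 : ∀ j, j ≠ z → 8 * m ^ 2 * (A + 1) ≤ d j)
    {θ : ℤ} (hθ : θ ≤ -((2 * m + 1) * A + 1)) {p : Equiv.Perm (Fin m) × (Fin m → Fin K)} (hp : IsDominant d v ε θ p) :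
    ∀ b, p.2 b = z := by
  intro b
  by_contra hb
  have hm1 : (1 : ℤ) ≤ m := by
    have : 0 < m := Fin.pos b
    exact_mod_cast this
  have hA : (0 : ℤ) ≤ A := by positivity
  set q : Equiv.Perm (Fin m) × (Fin m → Fin K) := (p.1, Function.update p.2 b z) with hq
  have hpres := (termSign_ne_zero_iff ε p).1 hp.1
  have hq_pres : termSign ε q ≠ 0 := by
    rw [termSign_ne_zero_iff]; intro b'
    by_cases hb' : b' = b
    · subst hb'; simp only [q, Function.update_self]; exact hdense _ _
    · simp only [q, Function.update_of_ne hb']; exact hpres b'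
  have hq_ne : q ≠ p := by
    intro hqp
    have : q.2 b = p.2 b := by rw [hqp]
    simp only [q, Function.update_self] at this
    exact hb this.symm
  have hdom := hp.2 q hq_ne hq_pres
  have hdiff := tropWeight_update d v θ p b z
  rw [hdz, hu _ _ (p.2 b) hb] at hdiff; push_cast at hdiff
  have hv := hvz (p.1 b) b; rw [abs_le] at hv
  have huj := huA (p.1 b) b (p.2 b); rw [abs_le] at huj
  have hdj : 8 * (m : ℤ) ^ 2 * (A + 1) ≤ d (p.2 b) := by exact_mod_cast hsep0 _ hb
  have hdj0 : (0 : ℤ) ≤ d (p.2 b) := by positivity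
  -- W q − W p = −v_z − θ d_j + d_j u_j ≥ −A + Θ d_j − d_j A > 0
  have h1 : ((2 * m + 1) * A + 1) * (d (p.2 b) : ℤ) ≤ -θ * (d (p.2 b) : ℤ) := mul_le_mul_of_nonneg_right (by linarith) hdj0
  have h2 : (d (p.2 b) : ℤ) * (-(A : ℤ)) ≤ (d (p.2 b) : ℤ) * u (p.1 b) b (p.2 b) := mul_le_mul_of_nonneg_left huj.1 hdj0
  have h3 : (0 : ℤ) ≤ (m : ℤ) * A * (d (p.2 b) : ℤ) := by positivity
  have h4 : (1 : ℤ) ≤ (m : ℤ) ^ 2 := by nlinarith [hm1]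
  have h5 : (A : ℤ) ≤ (m : ℤ) ^ 2 * A := le_mul_of_one_le_left hA h4
  have hq1 : tropWeight d v θ q = tropWeight d v θ (p.1, Function.update p.2 b z) := rfl
  rw [hq1] at hdom
  linarith [h1, h2, h3, h5, hv.2, hdom, hdiff, hdj, hm1, hA]

/-- **THE K = 3 SECTOR BOUND FOR EVERY CHAIN: `n ≤ 4m + 2`.**  Hypotheses of `chain_le_four_mul` without the window, plus a dense top
class: every chain of distinct consecutive terms dominant at strictly increasing integer slopes has `n ≤ 4·m + 2`. -/
theorem chain_le_four_mul_add_two (d : Fin K → ℕ) (v ε : Fin m → Fin m → Fin K → ℤ) (u : Fin m → Fin m → Fin K → ℤ)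
    (A : ℕ) (z w h : Fin K) (hwz : w ≠ z) (hhz : h ≠ z) (hdz : d z = 0) (hwh : d w < d h)
    (hinj : Function.Injective d)
    (hcls : ∀ a b j, ε a b j ≠ 0 → j = z ∨ j = w ∨ j = h)
    (hu : ∀ a b j, j ≠ z → v a b j = (d j : ℤ) * u a b j) (huA : ∀ a b j, |u a b j| ≤ A) (hvz : ∀ a b, |v a b z| ≤ A)
    (hdense : ∀ a b, ε a b z ≠ 0) (hdenseh : ∀ a b, ε a b h ≠ 0)
    (hsep : ∀ j j', d j < d j' → 8 * m ^ 2 * (A + 1) * d j ≤ d j') (hsep0 : ∀ j, j ≠ z → 8 * m ^ 2 * (A + 1) ≤ d j)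
    (hgenh : ∀ X Y : Finset (Fin m × Fin m), Literature.Computability.MetaComplexity.PBij.IsPMatching X →
      Literature.Computability.MetaComplexity.PBij.IsPMatching Y → (∀ e ∈ X, ε e.1 e.2 h ≠ 0) →
      (∀ e ∈ Y, ε e.1 e.2 h ≠ 0) → X.card = Y.card → ∑ e ∈ X, u e.1 e.2 h = ∑ e ∈ Y, u e.1 e.2 h → X = Y)
    (hgenw : ∀ X Y : Finset (Fin m × Fin m), Literature.Computability.MetaComplexity.PBij.IsPMatching X →
      Literature.Computability.MetaComplexity.PBij.IsPMatching Y → (∀ e ∈ X, ε e.1 e.2 w ≠ 0) →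
      (∀ e ∈ Y, ε e.1 e.2 w ≠ 0) → X.card = Y.card → ∑ e ∈ X, u e.1 e.2 w = ∑ e ∈ Y, u e.1 e.2 w → X = Y)
    {n : ℕ} (θ : Fin (n + 1) → ℤ) (p : Fin (n + 1) → Equiv.Perm (Fin m) × (Fin m → Fin K))
    (hθ : StrictMono θ) (hdom : ∀ k, IsDominant d v ε (θ k) (p k)) (hne : ∀ k : Fin n, p k.castSucc ≠ p k.succ) :
    n ≤ 4 * m + 2 := by
  -- an index above the window is the last one, an index below it is the first one
  have htop : ∀ k : Fin (n + 1), (2 * (m : ℤ) + 1) * A + 1 < θ k → (k : ℕ) = n := by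
    intro k hk
    by_contra hkn
    have hk' : (k : ℕ) < n := lt_of_le_of_ne (Nat.lt_succ_iff.1 k.2) hkn
    set k₀ : Fin n := ⟨k, hk'⟩ with hk₀
    have e0 : k₀.castSucc = k := Fin.ext rfl
    have hlt : θ k₀.castSucc < θ k₀.succ := hθ Fin.castSucc_lt_succ
    rw [e0] at hlt
    have h1 := cls_eq_top_of_ge d v ε u A z w h hwz hhz hdz hwh hcls hu huA hvz hdenseh hsep hsep0 hk.le (hdom k)
    have h2 := cls_eq_top_of_ge d v ε u A z w h hwz hhz hdz hwh hcls hu huA hvz hdenseh hsep hsep0 (by linarith) (hdom k₀.succ)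
    refine not_dominant_of_cls_eq d v ε (hdom k₀.castSucc) (hdom k₀.succ) (hne k₀) ?_
    funext b; rw [e0, h1 b, h2 b]
  have hbot : ∀ k : Fin (n + 1), θ k < -((2 * (m : ℤ) + 1) * A + 1) → (k : ℕ) = 0 := by
    intro k hk
    by_contra hk0
    have hk' : 0 < (k : ℕ) := Nat.pos_of_ne_zero hk0
    set k₀ : Fin n := ⟨k - 1, by omega⟩ with hk₀
    have e0 : k₀.succ = k := Fin.ext (by simp [hk₀]; omega)
    have hlt : θ k₀.castSucc < θ k₀.succ := hθ Fin.castSucc_lt_succ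
    rw [e0] at hlt
    have h1 := cls_eq_bot_of_le d v ε u A z hdz hu huA hvz hdense hsep0 hk.le (hdom k)
    have h2 := cls_eq_bot_of_le d v ε u A z hdz hu huA hvz hdense hsep0 (by linarith) (hdom k₀.castSucc)
    refine not_dominant_of_cls_eq d v ε (hdom k₀.castSucc) (hdom k₀.succ) (hne k₀) ?_
    funext b; rw [e0, h1 b, h2 b]
  -- trivial cases
  rcases Nat.lt_or_ge n 2 with hn | hn
  · omega
  -- the window block `[a, n − c]`
  let a : ℕ := if θ ⟨0, by omega⟩ < -((2 * (m : ℤ) + 1) * A + 1) then 1 else 0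
  let c : ℕ := if (2 * (m : ℤ) + 1) * A + 1 < θ ⟨n, by omega⟩ then 1 else 0
  have ha : a ≤ 1 := by simp only [a]; split_ifs <;> omega
  have hc : c ≤ 1 := by simp only [c]; split_ifs <;> omega
  have hwin : ∀ j : ℕ, a ≤ j → j + c ≤ n → ∀ hj : j < n + 1, |θ ⟨j, hj⟩| ≤ (2 * (m : ℤ) + 1) * A + 1 := by
    intro j haj hjc hj
    rw [abs_le]
    constructor
    · by_contra hlt
      rw [not_le] at hlt
      have := hbot ⟨j, hj⟩ hlt
      simp only at this
      subst this
      have : a = 1 := by simp only [a]; rw [if_pos hlt]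
      omega
    · by_contra hlt
      rw [not_le] at hlt
      have := htop ⟨j, hj⟩ hlt
      simp only at this
      subst this
      have : c = 1 := by simp only [c]; rw [if_pos hlt]
      omega
  -- the sub-chain on the window block
  set n' : ℕ := n - a - c with hn'
  let θ' : Fin (n' + 1) → ℤ := fun i => θ ⟨i + a, by omega⟩
  let p' : Fin (n' + 1) → Equiv.Perm (Fin m) × (Fin m → Fin K) := fun i => p ⟨i + a, by omega⟩
  have hθ' : StrictMono θ' := by
    intro i j hij
    exact hθ (by simp only [Fin.lt_def]; exact Nat.add_lt_add_right hij a)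
  have hdom' : ∀ i, IsDominant d v ε (θ' i) (p' i) := fun i => hdom _
  have hne' : ∀ i : Fin n', p' i.castSucc ≠ p' i.succ := by
    intro i
    have e1 : p' i.castSucc = p (⟨i + a, by omega⟩ : Fin n).castSucc := rfl
    have e2 : p' i.succ = p (⟨i + a, by omega⟩ : Fin n).succ := by
      simp only [p', Fin.succ_mk, Fin.val_succ]
      congr 1; exact Fin.ext (by simp; omega)
    rw [e1, e2]; exact hne _
  have hwin' : ∀ i : Fin (n' + 1), |θ' i| ≤ (2 * (m : ℤ) + 1) * A + 1 := by
    intro i; exact hwin (i + a) (by omega) (by omega) _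
  have hmain := chain_le_four_mul d v ε u A z w h hwz hhz hdz hwh hinj hcls hu huA hvz hdense hsep hsep0 hgenh hgenw θ' p' hθ'
    hwin' hdom' hne'
  omega

end SeparatedLex

end Summit.ValiantsHypothesis.ValiantsHypothesis.Theorems.KPlusLogSqLaw
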